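import Summits.HodgeConjecture.CorCM.GaloisCyclicSemidirectEightNormPairConverse
import Summits.HodgeConjecture.CorCM.GaloisCyclicSemidirectEightNormPairs
import Summits.HodgeConjecture.CorCM.GaloisCyclicSemidirectEightFiveModEight
import HarnessLib

/-!
# `C_p ⋊ C₈`: every primitive CM type is nondegenerate **iff** `ℤ/p` has no `μ₄`-norm pair — the dichotomy criterion

COR-CM (cell `pub-hodgecm2`), binder seat b04 (gen 29), count-neutral claim CYCLIC-SEMIDIRECT-EIGHT-DEGENERATE, part VIIIc
(capstone of parts V–VIII).  KERNEL ONLY: theorems; no definition, no named fact, no `sorry`.  `HC_CM` is neither used nor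
claimed: this is the Hodge conjecture for a NAMED CLASS of CM abelian varieties modulo ONE explicit, finite, combinatorial
hypothesis on the prime `p`, together with the proof that the hypothesis is also NECESSARY.

SETTING.  `K` a Galois CM field with `Gal(K/ℚ) ≅ C_p ⋊ C₈ = ⟨u, y | u^p = y⁸ = 1, y u y⁻¹ = u⁻¹⟩` (`p` an odd prime;
Mathlib model `Multiplicative (ZMod p) ⋊[φ] Multiplicative (ZMod 8)`, `φ(1)` = inversion; complex conjugation `y⁴`).  A
`μ₄`-NORM PAIR of `ℤ/p` is a pair of sheets `k₀, k₁ : ℤ/p → ℤ/4` for which, with `Nⱼ(d, r) = #{v : kⱼ(v) + kⱼ(v − d) = r}`,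
the integers `N₀(d,0) − N₀(d,2) + N₁(d,1) − N₁(d,3)` and `N₀(d,1) − N₀(d,3) + N₁(d,2) − N₁(d,0)` do not depend on `d`
(equivalently `G₀(ζ)G₀(ζ⁻¹) = i·G₁(ζ)G₁(ζ⁻¹)` for `Gⱼ(ζ) = Σ_v i^{kⱼ(v)} ζ_p^v`).

* **`forall_isNondegenerate_iff_forall_normPair_const`**: ALL PRIMITIVE CM TYPES OF `K` ARE NONDEGENERATE ⟺ every `μ₄`-norm
  pair of `ℤ/p` has constant first sheet (⟸: part VIIIb; ⟹: part V).  The classification of the family `C_p ⋊ C₈` is thus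
  a finite combinatorial question about `p` alone: GOOD (theorem, part IV) for every `p ≡ 5 (mod 8)`; BAD by certified
  pairs for `p = 3, 7, 11, 17, 19, 23, 31, 41, 71, 73, 89, 127` (parts III, VI and the certificate files); open otherwise
  (the seat's counting heuristic `#pairs ≈ 16^p (πp)^{−(p−3)/2}` predicts GOOD for generic `p ≳ 100`).
* `isNondegenerate_of_isPrimitive_of_forall_normPair_const`, `cmTypeRank_eq_of_isPrimitive_of_forall_normPair_const` (rank
  `4p + 1`), **`hodgeConjectureFor_pow_of_isSimple_of_forall_normPair_const`** (the HODGE CONJECTURE FOR ALL POWERS of every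
  SIMPLE abelian `4p`-fold with CM by `K`, under the combinatorial hypothesis), `hodgeConjectureFor_of_isSimple_…`,
  `hodgeClassSpan_pow_eq_divisorClassesSpan_of_isSimple_…` (`Bᵐ(Aⁿ) ⊗ ℂ = Dᵐ(Aⁿ) ⊗ ℂ`).
* `forall_normPair_const_of_mod_eight_eq_five`: conversely part IV's theorem shows that for `p ≡ 5 (mod 8)` no `μ₄`-norm
  pair with non-constant first sheet exists (given any Galois CM field with this group).

## References

* [Kubota1965] T. Kubota, *On the field extension by complex multiplication*, Trans. AMS 118 (1965), §2, §4 Lemma 2.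
* [Shimura1998] G. Shimura, *Abelian Varieties with Complex Multiplication and Modular Functions*, §8.2 Prop. 26.
* [Gordon1999HodgeAVSurvey] B. B. Gordon, *A survey of the Hodge conjecture for abelian varieties*, Thm. 6.4, §9.3, §9.4.
* [Dodson1984] B. Dodson, *The structure of Galois groups of CM-fields*, Trans. AMS 283 (1984), §3.1, §5.3.
-/

noncomputable section

open CategoryTheory CategoryTheory.Limits NumberField
open scoped BigOperators

namespace Summit.HodgeConjecture.CorCM.GaloisCyclicSemidirectEight

open Literature.NumberTheory.ComplexMultiplication
open Literature.AlgebraicGeometry.Motives (AbelianVariety CMType)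
open Literature.AlgebraicGeometry.HodgeTheory
open Literature.AlgebraicGeometry.ComplexMultiplication (IsCMTypeRealisation isSimple_iff_isPrimitive)
open Literature.AlgebraicGeometry.Pohlmann1968
open Summit.HodgeConjecture.CorCM.GaloisRank

section Field

variable {p : ℕ} [Fact p.Prime]
variable {K : Type} [Field K] [NumberField K] [IsCMField K] [IsGalois ℚ K]

/-- **NO `μ₄`-NORM PAIR ⟹ EVERY PRIMITIVE CM TYPE IS NONDEGENERATE.**  `Gal(K/ℚ) ≅ C_p ⋊ C₈` (`p` an odd prime, `φ(1)` =
inversion); if every pair of sheets `k₀, k₁ : ℤ/p → ℤ/4` satisfying the two balance identities of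
`CorCM/GaloisCyclicSemidirectEightNormPairs` has `k₀` constant, then every PRIMITIVE CM type of `K` is NONDEGENERATE.
[cite: Kubota1965, §4 Lemma 2] [cite: Shimura1998, §8.2 Prop. 26] -/
theorem isNondegenerate_of_isPrimitive_of_forall_normPair_const (hp2 : p ≠ 2)
    (φ : Multiplicative (ZMod 8) →* MulAut (Multiplicative (ZMod p)))
    (hφ : ∀ v : Multiplicative (ZMod p), φ (Multiplicative.ofAdd 1) v = v⁻¹)
    (hNP : ∀ k₀ k₁ : ZMod p → ZMod 4,
      (∀ d : ZMod p,
        (Finset.univ.filter fun v => k₀ v + k₀ (v - d) = 0).card +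
              (Finset.univ.filter fun v => k₁ v + k₁ (v - d) = 1).card +
            (Finset.univ.filter fun v => k₀ v + k₀ v = 2).card + (Finset.univ.filter fun v => k₁ v + k₁ v = 3).card =
          (Finset.univ.filter fun v => k₀ v + k₀ v = 0).card + (Finset.univ.filter fun v => k₁ v + k₁ v = 1).card +
              (Finset.univ.filter fun v => k₀ v + k₀ (v - d) = 2).card +
            (Finset.univ.filter fun v => k₁ v + k₁ (v - d) = 3).card) →
      (∀ d : ZMod p,
        (Finset.univ.filter fun v => k₀ v + k₀ (v - d) = 1).card +
              (Finset.univ.filter fun v => k₁ v + k₁ (v - d) = 2).card +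
            (Finset.univ.filter fun v => k₀ v + k₀ v = 3).card + (Finset.univ.filter fun v => k₁ v + k₁ v = 0).card =
          (Finset.univ.filter fun v => k₀ v + k₀ v = 1).card + (Finset.univ.filter fun v => k₁ v + k₁ v = 2).card +
              (Finset.univ.filter fun v => k₀ v + k₀ (v - d) = 3).card +
            (Finset.univ.filter fun v => k₁ v + k₁ (v - d) = 0).card) →
      ∀ v, k₀ v = k₀ 0)
    (e : (K ≃ₐ[ℚ] K) ≃* Multiplicative (ZMod p) ⋊[φ] Multiplicative (ZMod 8)) {Φ : CMType K} (φ₀ : K →+* ℂ)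
    (hprim : IsPrimitive (ℂ ≃+* ℂ) Φ.1 φ₀) : IsNondegenerate Φ := by
  classical
  have hp : p.Prime := Fact.out
  haveI : NeZero p := ⟨hp.ne_zero⟩
  haveI : Fintype (Multiplicative (ZMod p) ⋊[φ] Multiplicative (ZMod 8)) :=
    Fintype.ofEquiv _ SemidirectProduct.equivProd.symm
  have hc := map_complexConj_eq φ hφ hp2 e
  set S : Finset (Multiplicative (ZMod p) ⋊[φ] Multiplicative (ZMod 8)) :=
    Finset.univ.filter fun y => embOf φ₀ (e.symm y) ∈ Φ.1 with hS_def
  have hS : ∀ y, y ∈ S ↔ embOf φ₀ (e.symm y) ∈ Φ.1 := fun y => by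
    simp only [hS_def, Finset.mem_filter, Finset.mem_univ, true_and]
  have hScm := model_mul_mem_iff e hc Φ φ₀ S hS
  have hv1 : (SemidirectProduct.inl (Multiplicative.ofAdd (4 : ZMod p)) :
      Multiplicative (ZMod p) ⋊[φ] Multiplicative (ZMod 8)) ≠ 1 := by
    intro h
    rw [← map_one (SemidirectProduct.inl : Multiplicative (ZMod p) →* _), SemidirectProduct.inl_inj] at h
    have h4 : (4 : ZMod p) = 0 := by
      have := congrArg Multiplicative.toAdd h
      simpa using this
    rw [show (4 : ZMod p) = ((2 ^ 2 : ℕ) : ZMod p) by norm_num, ZMod.natCast_eq_zero_iff] at h4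
    exact hp2 ((Nat.prime_dvd_prime_iff_eq hp Nat.prime_two).1 (hp.dvd_of_dvd_pow h4))
  have hstab : ¬ ∀ w : Multiplicative (ZMod p) ⋊[φ] Multiplicative (ZMod 8),
      w ∈ S ↔ SemidirectProduct.inl (Multiplicative.ofAdd (4 : ZMod p)) * w ∈ S :=
    fun h => not_isPrimitive_of_leftStabiliser e Φ φ₀ S hS hv1 h hprim
  exact (isNondegenerate_iff_forall_annihilator e hc Φ φ₀ S hS).2 fun b hb hann =>
    eq_zero_of_annihilated_of_forall_normPair_const hp2 φ hφ hNP S hScm hstab b hb hann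

/-- **THE DICHOTOMY CRITERION (iff).**  For a Galois CM field `K` with `Gal(K/ℚ) ≅ C_p ⋊ C₈` (`p` an odd prime, `φ(1)` =
inversion): EVERY PRIMITIVE CM TYPE OF `K` IS NONDEGENERATE if and only if `ℤ/p` carries NO `μ₄`-NORM PAIR with non-constant
first sheet — a purely combinatorial property of `p` (parts V–VII: a norm pair gives a primitive degenerate type; conversely
a singular two-sheet block is a norm pair by the `ℚ(i)`-independence of the `p`-th roots of unity).  GOOD so far exactly for
`p ≡ 5 (mod 8)`; BAD (certified pairs) for `p = 3, 7, 11, 17, 19, 23, 31, 41, 71, 73, 89, 127`.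
[cite: Kubota1965, §2 and §4 Lemma 2] [cite: Shimura1998, §8.2 Prop. 26] -/
theorem forall_isNondegenerate_iff_forall_normPair_const (hp2 : p ≠ 2)
    (φ : Multiplicative (ZMod 8) →* MulAut (Multiplicative (ZMod p)))
    (hφ : ∀ v : Multiplicative (ZMod p), φ (Multiplicative.ofAdd 1) v = v⁻¹)
    (e : (K ≃ₐ[ℚ] K) ≃* Multiplicative (ZMod p) ⋊[φ] Multiplicative (ZMod 8)) :
    (∀ (Φ : CMType K) (φ₀ : K →+* ℂ), IsPrimitive (ℂ ≃+* ℂ) Φ.1 φ₀ → IsNondegenerate Φ) ↔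
    (∀ k₀ k₁ : ZMod p → ZMod 4,
      (∀ d : ZMod p,
        (Finset.univ.filter fun v => k₀ v + k₀ (v - d) = 0).card +
              (Finset.univ.filter fun v => k₁ v + k₁ (v - d) = 1).card +
            (Finset.univ.filter fun v => k₀ v + k₀ v = 2).card + (Finset.univ.filter fun v => k₁ v + k₁ v = 3).card =
          (Finset.univ.filter fun v => k₀ v + k₀ v = 0).card + (Finset.univ.filter fun v => k₁ v + k₁ v = 1).card +
              (Finset.univ.filter fun v => k₀ v + k₀ (v - d) = 2).card +
            (Finset.univ.filter fun v => k₁ v + k₁ (v - d) = 3).card) →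
      (∀ d : ZMod p,
        (Finset.univ.filter fun v => k₀ v + k₀ (v - d) = 1).card +
              (Finset.univ.filter fun v => k₁ v + k₁ (v - d) = 2).card +
            (Finset.univ.filter fun v => k₀ v + k₀ v = 3).card + (Finset.univ.filter fun v => k₁ v + k₁ v = 0).card =
          (Finset.univ.filter fun v => k₀ v + k₀ v = 1).card + (Finset.univ.filter fun v => k₁ v + k₁ v = 2).card +
              (Finset.univ.filter fun v => k₀ v + k₀ (v - d) = 3).card +
            (Finset.univ.filter fun v => k₁ v + k₁ (v - d) = 0).card) →
      ∀ v, k₀ v = k₀ 0) := by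
  refine ⟨fun hall k₀ k₁ hR hI => ?_, fun hNP Φ φ₀ hprim =>
    isNondegenerate_of_isPrimitive_of_forall_normPair_const hp2 φ hφ hNP e φ₀ hprim⟩
  by_contra hk
  push Not at hk
  obtain ⟨v, hv⟩ := hk
  obtain ⟨Φ, φ₀, A, ι, θ, hprim, hdeg, -⟩ := exists_simple_degenerate_of_normPair hp2 φ hφ e k₀ k₁ ⟨v, hv⟩ hR hI
  exact hdeg (hall Φ φ₀ hprim)

/-- The rank: under the no-norm-pair hypothesis every primitive CM type has `cmTypeRank Φ = 4p + 1`.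
[cite: Kubota1965, §2 (p. 115)] -/
theorem cmTypeRank_eq_of_isPrimitive_of_forall_normPair_const (hp2 : p ≠ 2)
    (φ : Multiplicative (ZMod 8) →* MulAut (Multiplicative (ZMod p)))
    (hφ : ∀ v : Multiplicative (ZMod p), φ (Multiplicative.ofAdd 1) v = v⁻¹)
    (hNP : ∀ k₀ k₁ : ZMod p → ZMod 4,
      (∀ d : ZMod p,
        (Finset.univ.filter fun v => k₀ v + k₀ (v - d) = 0).card +
              (Finset.univ.filter fun v => k₁ v + k₁ (v - d) = 1).card +
            (Finset.univ.filter fun v => k₀ v + k₀ v = 2).card + (Finset.univ.filter fun v => k₁ v + k₁ v = 3).card =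
          (Finset.univ.filter fun v => k₀ v + k₀ v = 0).card + (Finset.univ.filter fun v => k₁ v + k₁ v = 1).card +
              (Finset.univ.filter fun v => k₀ v + k₀ (v - d) = 2).card +
            (Finset.univ.filter fun v => k₁ v + k₁ (v - d) = 3).card) →
      (∀ d : ZMod p,
        (Finset.univ.filter fun v => k₀ v + k₀ (v - d) = 1).card +
              (Finset.univ.filter fun v => k₁ v + k₁ (v - d) = 2).card +
            (Finset.univ.filter fun v => k₀ v + k₀ v = 3).card + (Finset.univ.filter fun v => k₁ v + k₁ v = 0).card =
          (Finset.univ.filter fun v => k₀ v + k₀ v = 1).card + (Finset.univ.filter fun v => k₁ v + k₁ v = 2).card +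
              (Finset.univ.filter fun v => k₀ v + k₀ (v - d) = 3).card +
            (Finset.univ.filter fun v => k₁ v + k₁ (v - d) = 0).card) →
      ∀ v, k₀ v = k₀ 0)
    (e : (K ≃ₐ[ℚ] K) ≃* Multiplicative (ZMod p) ⋊[φ] Multiplicative (ZMod 8)) {Φ : CMType K} (φ₀ : K →+* ℂ)
    (hprim : IsPrimitive (ℂ ≃+* ℂ) Φ.1 φ₀) : cmTypeRank Φ = 4 * p + 1 := by
  have h := isNondegenerate_of_isPrimitive_of_forall_normPair_const hp2 φ hφ hNP e φ₀ hprim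
  rw [isNondegenerate_iff, finrank_eq φ e] at h
  rw [h]; omega

end Field

/-! ## The Hodge conjecture for the simple CM abelian `4p`-folds and their powers, under the combinatorial hypothesis -/

section Geometry

variable {p : ℕ} [Fact p.Prime]
variable {K : Type} [Field K] [NumberField K] [IsCMField K] [IsGalois ℚ K]
variable {Φ : CMType K} {A : AbelianVariety ℂ} {ι : 𝓞 K →+* End A}
  {θ : K →+* Module.End ℂ (complexBetti A.X 1)}

/-- **THE HODGE CONJECTURE FOR EVERY POWER OF EVERY SIMPLE ABELIAN VARIETY (of dimension `4p`) WITH COMPLEX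
MULTIPLICATION BY A GALOIS CM FIELD WITH GROUP `C_p ⋊ C₈`, AS SOON AS `ℤ/p` HAS NO `μ₄`-NORM PAIR** (a finite check on `p`;
e.g. every `p ≡ 5 (mod 8)` by part IV). [cite: Gordon1999HodgeAVSurvey, Thm. 6.4] [cite: Shimura1998, §8.2 Prop. 26] -/
theorem hodgeConjectureFor_pow_of_isSimple_of_forall_normPair_const (hp2 : p ≠ 2)
    (φ : Multiplicative (ZMod 8) →* MulAut (Multiplicative (ZMod p)))
    (hφ : ∀ v : Multiplicative (ZMod p), φ (Multiplicative.ofAdd 1) v = v⁻¹)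
    (hNP : ∀ k₀ k₁ : ZMod p → ZMod 4,
      (∀ d : ZMod p,
        (Finset.univ.filter fun v => k₀ v + k₀ (v - d) = 0).card +
              (Finset.univ.filter fun v => k₁ v + k₁ (v - d) = 1).card +
            (Finset.univ.filter fun v => k₀ v + k₀ v = 2).card + (Finset.univ.filter fun v => k₁ v + k₁ v = 3).card =
          (Finset.univ.filter fun v => k₀ v + k₀ v = 0).card + (Finset.univ.filter fun v => k₁ v + k₁ v = 1).card +
              (Finset.univ.filter fun v => k₀ v + k₀ (v - d) = 2).card +
            (Finset.univ.filter fun v => k₁ v + k₁ (v - d) = 3).card) →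
      (∀ d : ZMod p,
        (Finset.univ.filter fun v => k₀ v + k₀ (v - d) = 1).card +
              (Finset.univ.filter fun v => k₁ v + k₁ (v - d) = 2).card +
            (Finset.univ.filter fun v => k₀ v + k₀ v = 3).card + (Finset.univ.filter fun v => k₁ v + k₁ v = 0).card =
          (Finset.univ.filter fun v => k₀ v + k₀ v = 1).card + (Finset.univ.filter fun v => k₁ v + k₁ v = 2).card +
              (Finset.univ.filter fun v => k₀ v + k₀ (v - d) = 3).card +
            (Finset.univ.filter fun v => k₁ v + k₁ (v - d) = 0).card) →
      ∀ v, k₀ v = k₀ 0)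
    (e : (K ≃ₐ[ℚ] K) ≃* Multiplicative (ZMod p) ⋊[φ] Multiplicative (ZMod 8)) (hA : IsCMTypeRealisation Φ A ι θ)
    (hs : A.IsSimple) (N : ℕ) :
    HodgeConjectureFor (⨁ fun _ : Fin N => A).dim (⨁ fun _ : Fin N => A).X := by
  obtain ⟨φ₀⟩ := (inferInstance : Nonempty (K →+* ℂ))
  exact (isNondegenerate_of_isPrimitive_of_forall_normPair_const hp2 φ hφ hNP e φ₀
    ((isSimple_iff_isPrimitive hA φ₀).1 hs)).hodgeConjectureFor_pow hA N

/-- The Hodge conjecture for the simple abelian variety itself. [cite: Gordon1999HodgeAVSurvey, Thm. 6.4] -/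
theorem hodgeConjectureFor_of_isSimple_of_forall_normPair_const (hp2 : p ≠ 2)
    (φ : Multiplicative (ZMod 8) →* MulAut (Multiplicative (ZMod p)))
    (hφ : ∀ v : Multiplicative (ZMod p), φ (Multiplicative.ofAdd 1) v = v⁻¹)
    (hNP : ∀ k₀ k₁ : ZMod p → ZMod 4,
      (∀ d : ZMod p,
        (Finset.univ.filter fun v => k₀ v + k₀ (v - d) = 0).card +
              (Finset.univ.filter fun v => k₁ v + k₁ (v - d) = 1).card +
            (Finset.univ.filter fun v => k₀ v + k₀ v = 2).card + (Finset.univ.filter fun v => k₁ v + k₁ v = 3).card =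
          (Finset.univ.filter fun v => k₀ v + k₀ v = 0).card + (Finset.univ.filter fun v => k₁ v + k₁ v = 1).card +
              (Finset.univ.filter fun v => k₀ v + k₀ (v - d) = 2).card +
            (Finset.univ.filter fun v => k₁ v + k₁ (v - d) = 3).card) →
      (∀ d : ZMod p,
        (Finset.univ.filter fun v => k₀ v + k₀ (v - d) = 1).card +
              (Finset.univ.filter fun v => k₁ v + k₁ (v - d) = 2).card +
            (Finset.univ.filter fun v => k₀ v + k₀ v = 3).card + (Finset.univ.filter fun v => k₁ v + k₁ v = 0).card =
          (Finset.univ.filter fun v => k₀ v + k₀ v = 1).card + (Finset.univ.filter fun v => k₁ v + k₁ v = 2).card +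
              (Finset.univ.filter fun v => k₀ v + k₀ (v - d) = 3).card +
            (Finset.univ.filter fun v => k₁ v + k₁ (v - d) = 0).card) →
      ∀ v, k₀ v = k₀ 0)
    (e : (K ≃ₐ[ℚ] K) ≃* Multiplicative (ZMod p) ⋊[φ] Multiplicative (ZMod 8)) (hA : IsCMTypeRealisation Φ A ι θ)
    (hs : A.IsSimple) : HodgeConjectureFor A.dim A.X := by
  obtain ⟨φ₀⟩ := (inferInstance : Nonempty (K →+* ℂ))
  exact (isNondegenerate_of_isPrimitive_of_forall_normPair_const hp2 φ hφ hNP e φ₀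
    ((isSimple_iff_isPrimitive hA φ₀).1 hs)).hodgeConjectureFor hA

/-- `Bᵐ(Aⁿ) ⊗ ℂ = Dᵐ(Aⁿ) ⊗ ℂ` on every power of such a simple abelian variety. [cite: Gordon1999HodgeAVSurvey, §9.3] -/
theorem hodgeClassSpan_pow_eq_divisorClassesSpan_of_isSimple_of_forall_normPair_const (hp2 : p ≠ 2)
    (φ : Multiplicative (ZMod 8) →* MulAut (Multiplicative (ZMod p)))
    (hφ : ∀ v : Multiplicative (ZMod p), φ (Multiplicative.ofAdd 1) v = v⁻¹)
    (hNP : ∀ k₀ k₁ : ZMod p → ZMod 4,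
      (∀ d : ZMod p,
        (Finset.univ.filter fun v => k₀ v + k₀ (v - d) = 0).card +
              (Finset.univ.filter fun v => k₁ v + k₁ (v - d) = 1).card +
            (Finset.univ.filter fun v => k₀ v + k₀ v = 2).card + (Finset.univ.filter fun v => k₁ v + k₁ v = 3).card =
          (Finset.univ.filter fun v => k₀ v + k₀ v = 0).card + (Finset.univ.filter fun v => k₁ v + k₁ v = 1).card +
              (Finset.univ.filter fun v => k₀ v + k₀ (v - d) = 2).card +
            (Finset.univ.filter fun v => k₁ v + k₁ (v - d) = 3).card) →
      (∀ d : ZMod p,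
        (Finset.univ.filter fun v => k₀ v + k₀ (v - d) = 1).card +
              (Finset.univ.filter fun v => k₁ v + k₁ (v - d) = 2).card +
            (Finset.univ.filter fun v => k₀ v + k₀ v = 3).card + (Finset.univ.filter fun v => k₁ v + k₁ v = 0).card =
          (Finset.univ.filter fun v => k₀ v + k₀ v = 1).card + (Finset.univ.filter fun v => k₁ v + k₁ v = 2).card +
              (Finset.univ.filter fun v => k₀ v + k₀ (v - d) = 3).card +
            (Finset.univ.filter fun v => k₁ v + k₁ (v - d) = 0).card) →
      ∀ v, k₀ v = k₀ 0)
    (e : (K ≃ₐ[ℚ] K) ≃* Multiplicative (ZMod p) ⋊[φ] Multiplicative (ZMod 8)) (hA : IsCMTypeRealisation Φ A ι θ)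
    (hs : A.IsSimple) (N m : ℕ) :
    Literature.AlgebraicGeometry.VanGeemen1994.hodgeClassSpan (⨁ fun _ : Fin N => A).dim (⨁ fun _ : Fin N => A).X m =
      Literature.Barriers.HodgeConjecture.divisorClassesSpan (⨁ fun _ : Fin N => A).X
        (⨁ fun _ : Fin N => A).dim m := by
  obtain ⟨φ₀⟩ := (inferInstance : Nonempty (K →+* ℂ))
  exact (isNondegenerate_of_isPrimitive_of_forall_normPair_const hp2 φ hφ hNP e φ₀
    ((isSimple_iff_isPrimitive hA φ₀).1 hs)).hodgeClassSpan_pow_eq_divisorClassesSpan hA N m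

/-- **… and conversely the norm-pair obstruction is genuinely absent for `p ≡ 5 (mod 8)`**: for such `p` (part IV: GOOD)
`ℤ/p` carries no `μ₄`-norm pair with non-constant first sheet — a combinatorial fact about `ℤ/p` read off the Hodge
theory of any Galois CM field with group `C_p ⋊ C₈`. [cite: Kubota1965, §4 Lemma 2] -/
theorem forall_normPair_const_of_mod_eight_eq_five (hp8 : p % 8 = 5)
    (φ : Multiplicative (ZMod 8) →* MulAut (Multiplicative (ZMod p)))
    (hφ : ∀ v : Multiplicative (ZMod p), φ (Multiplicative.ofAdd 1) v = v⁻¹)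
    (e : (K ≃ₐ[ℚ] K) ≃* Multiplicative (ZMod p) ⋊[φ] Multiplicative (ZMod 8)) (k₀ k₁ : ZMod p → ZMod 4)
    (hR : ∀ d : ZMod p,
      (Finset.univ.filter fun v => k₀ v + k₀ (v - d) = 0).card +
            (Finset.univ.filter fun v => k₁ v + k₁ (v - d) = 1).card +
          (Finset.univ.filter fun v => k₀ v + k₀ v = 2).card + (Finset.univ.filter fun v => k₁ v + k₁ v = 3).card =
        (Finset.univ.filter fun v => k₀ v + k₀ v = 0).card + (Finset.univ.filter fun v => k₁ v + k₁ v = 1).card +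
            (Finset.univ.filter fun v => k₀ v + k₀ (v - d) = 2).card +
          (Finset.univ.filter fun v => k₁ v + k₁ (v - d) = 3).card)
    (hI : ∀ d : ZMod p,
      (Finset.univ.filter fun v => k₀ v + k₀ (v - d) = 1).card +
            (Finset.univ.filter fun v => k₁ v + k₁ (v - d) = 2).card +
          (Finset.univ.filter fun v => k₀ v + k₀ v = 3).card + (Finset.univ.filter fun v => k₁ v + k₁ v = 0).card =
        (Finset.univ.filter fun v => k₀ v + k₀ v = 1).card + (Finset.univ.filter fun v => k₁ v + k₁ v = 2).card +
            (Finset.univ.filter fun v => k₀ v + k₀ (v - d) = 3).card +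
          (Finset.univ.filter fun v => k₁ v + k₁ (v - d) = 0).card) :
    ∀ v, k₀ v = k₀ 0 :=
  (forall_isNondegenerate_iff_forall_normPair_const (ne_two_of_mod_eight_eq_five hp8) φ hφ e).1
    (fun _ φ₀ hprim => isNondegenerate_of_isPrimitive_of_mod_eight_eq_five hp8 φ hφ e φ₀ hprim) k₀ k₁ hR hI

end Geometry

end Summit.HodgeConjecture.CorCM.GaloisCyclicSemidirectEight

end
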